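import Mathlib
import HarnessLib
import Summits.Ventures.LatticeQCDFlow.Exactness.PTBCSwap

/-!
# Parallel tempered metadynamics (PT-MetaD): the swap test sees only the bias, and with a STATIC bias the measurement stream is exact

HONEST FRAMING: exact (Metropolis-corrected) sampling algorithms for lattice gauge theory;
figures of merit are autocorrelation/cost numbers at stated couplings and volumes; no
continuum-physics claim.

Venture `LatticeQCDFlow` (cell pub-lqcd), topic `Exactness`; FANOUT row 22 (`su3-ptbc`), whose
acceptance card carries, besides the PTBC arm E4 (`PTBCSwap.lean`, `PTBCSwapEnergy.lean`,
`PTBCSwapMonitor.lean`), the PT-MetaD arm E5 (HOME `su3-ptbc/CARD-su3-ptbc.md` §6): two streams with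
the SAME physical action `S`, stream `y` carrying a bias potential `V (Q y)` on a collective variable
`Q` (the metadynamics stream), stream `x` unbiased (the measurement stream), exchange proposals
Metropolis-tested.  NEW WORK of the cell = corollaries of the tree's `PTBCSwap.lean` (the two-action
replica swap is exact for EVERY pair of measurable actions) and of Mathlib's product-measure API;
nothing here is cited as a fact.  Printed counterpart, NAMED ONLY: Eichhorn–Fuwa–Hoelbling–Varnhorst,
PRD 109 (2024) 114504 = arXiv:2307.04742 §VI, eq. (20) (`ΔS = V_t(Q_meta,1) − V_t(Q_meta,2)`; «the
contributions from the physical action are always canceled»; «the second/measurement stream samples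
configurations according to the physical distribution, no reweighting is needed»).

## Content (reference measure `vol` on one stream's configuration space `Ω`; slot 1 = the
measurement stream `x` with action `S`, slot 2 = the biased stream `y` with action
`biasedAction S V Q = S + V ∘ Q`)

* §1 `ptMetaDEnergy_swap_sub`, **`involAccept_ptMetaD`** — the exchange is accepted with probability
  `min {1, exp (V (Q y) − V (Q x))}`: the physical action cancels identically, whatever it is (in
  particular the test costs `O(1)` and is the same with dynamical fermions in `S`);
  `involAccept_ptMetaD_indep` — two physical actions give the same test.
* §2 `ptMetaDSwap` (the pair kernel = the tree's `involMH` swap for the pair energy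
  `S x + (S y + V (Q y))`), `ptMetaDLaw` (the static pair law `e^{−S(x) − S(y) − V(Q y)} vol ⊗ vol`);
  **`ptMetaDSwap_invariant`** (instance of `ptbcSwap_invariant`); `ptMetaDLaw_eq_prod` (it is the
  product of the physical law `e^{−S} vol` and the biased law `e^{−S − V∘Q} vol`);
  **`ptMetaDLaw_map_fst`**, **`integral_measurement_ptMetaDLaw`** — EXACTNESS OF THE MEASUREMENT
  STREAM for a static bias: the slot-1 marginal of the invariant pair law is the physical law (times
  the biased stream's mass), so every measurement `f (x)` has the physical expectation; no reweighting.

## Not here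

The in-stream updates (MetaD-HMC on `y`, 1HB+4OR on `x`) and the full-cycle ergodicity — covered
verbatim by row 9's `ptbc_uniformlyErgodic_of_inReplica` (`PTBCTranslationErgodic.lean`) with two
replicas, actions `S` and `S + V ∘ Q`, and the identity as translation; a bias UPDATED between swaps
(the metadynamics build-up phase) is NOT a static pair chain and is treated in the companion file
`PTMetaDAdaptiveBias.lean` (exact iff the biased stream is re-equilibrated after each update; finite
witnesses otherwise); swap rates, autocorrelation times, anything measured.
-/

noncomputable section

namespace Summit.Ventures.LatticeQCDFlow.Exactness

open MeasureTheory ProbabilityTheory Real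
open scoped ENNReal

variable {Ω : Type*} [MeasurableSpace Ω] {γ : Type*}

/-! ## §1 The swap test sees only the bias -/

/-- The biased (metadynamics) stream's action: the physical action plus the bias potential `V`
evaluated on the collective variable `Q`. -/
def biasedAction (S : Ω → ℝ) (V : γ → ℝ) (Q : Ω → γ) : Ω → ℝ := fun ω => S ω + V (Q ω)

omit [MeasurableSpace Ω] in
/-- Unfolding lemma for the biased action. -/
@[simp] theorem biasedAction_apply (S : Ω → ℝ) (V : γ → ℝ) (Q : Ω → γ) (ω : Ω) :
    biasedAction S V Q ω = S ω + V (Q ω) := rfl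

/-- The biased action is measurable when `S` and `V ∘ Q` are. -/
theorem measurable_biasedAction {S : Ω → ℝ} {V : γ → ℝ} {Q : Ω → γ} (hS : Measurable S)
    (hVQ : Measurable fun ω => V (Q ω)) : Measurable (biasedAction S V Q) :=
  hS.add hVQ

/-- The pair energy of PT-MetaD: measurement stream (slot 1, action `S`) holding `z.1`, biased
stream (slot 2, action `S + V ∘ Q`) holding `z.2`. -/
def ptMetaDEnergy (S : Ω → ℝ) (V : γ → ℝ) (Q : Ω → γ) (z : Ω × Ω) : ℝ :=
  S z.1 + biasedAction S V Q z.2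

omit [MeasurableSpace Ω] in
/-- **The PT-MetaD swap energy is the bias difference**: with the measurement stream holding `x`
and the biased stream holding `y`, the change of the pair energy under the exchange is
`ΔS = V (Q x) − V (Q y)` — the physical action cancels (arXiv:2307.04742 eq. (20), named only). -/
theorem ptMetaDEnergy_swap_sub (S : Ω → ℝ) (V : γ → ℝ) (Q : Ω → γ) (x y : Ω) :
    ptMetaDEnergy S V Q (y, x) - ptMetaDEnergy S V Q (x, y) = V (Q x) - V (Q y) := by
  simp only [ptMetaDEnergy, biasedAction]
  ring

/-- **The PT-MetaD swap test**: the exchange `(x, y) ↦ (y, x)` is accepted with probability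
`min {1, exp (V (Q y) − V (Q x))}` — a function of the two collective variables and the bias alone;
in particular it is accepted surely whenever the biased stream sits at the higher bias. -/
theorem involAccept_ptMetaD (S : Ω → ℝ) (V : γ → ℝ) (Q : Ω → γ) (x y : Ω) :
    involAccept (fun z : Ω × Ω => S z.1 + biasedAction S V Q z.2)
        (trexSwap (MeasurableEquiv.refl Ω)) (x, y) = min 1 (Real.exp (V (Q y) - V (Q x))) := by
  rw [involAccept_ptbcSwap]
  congr 2
  simp only [biasedAction]
  ring

/-- **Independence of the physical action**: two physical actions `S`, `S'` (e.g. with and without a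
fermion determinant) give the same swap test. -/
theorem involAccept_ptMetaD_indep (S S' : Ω → ℝ) (V : γ → ℝ) (Q : Ω → γ) (z : Ω × Ω) :
    involAccept (fun z : Ω × Ω => S z.1 + biasedAction S V Q z.2)
        (trexSwap (MeasurableEquiv.refl Ω)) z =
      involAccept (fun z : Ω × Ω => S' z.1 + biasedAction S' V Q z.2)
        (trexSwap (MeasurableEquiv.refl Ω)) z := by
  obtain ⟨x, y⟩ := z
  rw [involAccept_ptMetaD, involAccept_ptMetaD]

/-! ## §2 Static bias: the pair kernel, its invariant law, and the exactness of the measurement stream -/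

/-- **The PT-MetaD pair kernel**: propose the exchange of the two streams' configurations, accept
with `min {1, exp (V (Q y) − V (Q x))}` (`involAccept_ptMetaD`), else stay — the tree's
deterministic-involution Metropolis kernel for the pair energy `S x + (S y + V (Q y))`. -/
def ptMetaDSwap (S : Ω → ℝ) (V : γ → ℝ) (Q : Ω → γ) : Kernel (Ω × Ω) (Ω × Ω) :=
  involMH (trexSwap (MeasurableEquiv.refl Ω)) (measurable_trexSwap _)
    (fun z : Ω × Ω => S z.1 + biasedAction S V Q z.2)

/-- **The static PT-MetaD pair law** `e^{−S(x) − (S(y) + V(Q y))} (vol ⊗ vol)` (un-normalised). -/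
def ptMetaDLaw (vol : Measure Ω) (S : Ω → ℝ) (V : γ → ℝ) (Q : Ω → γ) : Measure (Ω × Ω) :=
  (vol.prod vol).withDensity fun z => ENNReal.ofReal (Real.exp (-(S z.1 + biasedAction S V Q z.2)))

/-- The physical (measurement-stream) law `e^{−S} vol` (un-normalised). -/
def physicalLaw (vol : Measure Ω) (S : Ω → ℝ) : Measure Ω :=
  vol.withDensity fun x => ENNReal.ofReal (Real.exp (-S x))

variable {vol : Measure Ω} [SFinite vol] {S : Ω → ℝ} {V : γ → ℝ} {Q : Ω → γ}

/-- The physical law of an s-finite reference measure is s-finite. -/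
instance sFinite_physicalLaw (S : Ω → ℝ) : SFinite (physicalLaw vol S) := by
  unfold physicalLaw
  infer_instance

/-- **PT-MetaD with a static bias is exact for the pair law** — instance of the tree's
`ptbcSwap_invariant` with the two actions `S` and `S + V ∘ Q`. -/
theorem ptMetaDSwap_invariant (hS : Measurable S) (hVQ : Measurable fun ω => V (Q ω)) :
    Kernel.Invariant (ptMetaDSwap S V Q) (ptMetaDLaw vol S V Q) :=
  ptbcSwap_invariant hS (measurable_biasedAction hS hVQ)

/-- The pair kernel is reversible for the pair law (detailed balance). -/
theorem ptMetaDSwap_isReversible (hS : Measurable S) (hVQ : Measurable fun ω => V (Q ω)) :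
    Kernel.IsReversible (ptMetaDSwap S V Q) (ptMetaDLaw vol S V Q) :=
  ptbcSwap_isReversible hS (measurable_biasedAction hS hVQ)

/-- **The static pair law is a product**: physical law on the measurement slot times the biased law
`e^{−S − V∘Q} vol` on the metadynamics slot. -/
theorem ptMetaDLaw_eq_prod (hS : Measurable S) (hVQ : Measurable fun ω => V (Q ω)) :
    ptMetaDLaw vol S V Q =
      (physicalLaw vol S).prod (physicalLaw vol (biasedAction S V Q)) := by
  have h1 : Measurable fun x => ENNReal.ofReal (Real.exp (-S x)) :=
    (measurable_exp.comp hS.neg).ennreal_ofReal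
  have h2 : Measurable fun y => ENNReal.ofReal (Real.exp (-(biasedAction S V Q y))) :=
    (measurable_exp.comp (measurable_biasedAction hS hVQ).neg).ennreal_ofReal
  rw [physicalLaw, physicalLaw, prod_withDensity h1 h2, ptMetaDLaw]
  congr 1
  funext z
  rw [← ENNReal.ofReal_mul (Real.exp_pos _).le, ← Real.exp_add]
  congr 2
  ring

/-- **Exactness of the measurement stream (law)**: the slot-1 marginal of the static pair law is the
physical law, scaled by the total mass `Z_b` of the biased law — after normalisation, exactly the
physical distribution; no reweighting. -/
theorem ptMetaDLaw_map_fst (hS : Measurable S) (hVQ : Measurable fun ω => V (Q ω)) :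
    (ptMetaDLaw vol S V Q).map Prod.fst =
      physicalLaw vol (biasedAction S V Q) Set.univ • physicalLaw vol S := by
  rw [ptMetaDLaw_eq_prod hS hVQ, Measure.map_fst_prod]

/-- **Exactness of the measurement stream (expectations)**: for every observable `f` of the
measurement stream, `∫ f (x) d(pair law) = Z_b · ∫ f d(e^{−S} vol)`. -/
theorem integral_measurement_ptMetaDLaw (hS : Measurable S) (hVQ : Measurable fun ω => V (Q ω))
    {E : Type*} [NormedAddCommGroup E] [NormedSpace ℝ E] (f : Ω → E) :
    ∫ z, f z.1 ∂(ptMetaDLaw vol S V Q) =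
      (physicalLaw vol (biasedAction S V Q)).real Set.univ • ∫ x, f x ∂(physicalLaw vol S) := by
  rw [ptMetaDLaw_eq_prod hS hVQ]
  exact integral_fun_fst f

/-- **Normalised form**: if the biased law has been normalised to a probability measure (replace
`V` by `V + log Z_b`, which changes neither the swap test — `involAccept_ptMetaD` — nor the
kernel), the measurement marginal IS the physical law. -/
theorem ptMetaDLaw_fst_of_isProbabilityMeasure (hS : Measurable S) (hVQ : Measurable fun ω => V (Q ω))
    [IsProbabilityMeasure (physicalLaw vol (biasedAction S V Q))] :
    (ptMetaDLaw vol S V Q).fst = physicalLaw vol S := by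
  rw [ptMetaDLaw_eq_prod hS hVQ, Measure.fst_prod]

/-- Shifting the bias by a constant does not change the swap test (so the normalisation above is
harmless). -/
theorem involAccept_ptMetaD_add_const (S : Ω → ℝ) (V : γ → ℝ) (Q : Ω → γ) (c : ℝ) (z : Ω × Ω) :
    involAccept (fun z : Ω × Ω => S z.1 + biasedAction S (fun q => V q + c) Q z.2)
        (trexSwap (MeasurableEquiv.refl Ω)) z =
      involAccept (fun z : Ω × Ω => S z.1 + biasedAction S V Q z.2)
        (trexSwap (MeasurableEquiv.refl Ω)) z := by
  obtain ⟨x, y⟩ := z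
  rw [involAccept_ptMetaD, involAccept_ptMetaD]
  congr 2
  ring

end Summit.Ventures.LatticeQCDFlow.Exactness

end
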